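import Summits.QuantumFields.YangMills.Theorems.F4SubCurvatureDoorSubCurvatureKernelHalfSpace
import Mathlib
import HarnessLib

/-!
# Route `F4SubCurvatureDoor`, crux `SubCurvatureKernel` ⟨stmt-QuantumFields-23036⟩ — soft half, input (C) «continuity off 0»,
# part 6 (capstone): the extracted real kernel HAS A VERSION CONTINUOUS OFF `0`

Helper file (`--supports stmt-QuantumFields-23036 --as helper`; free-hands seat `ym-line-frs-p2` g18).  Definition-free, 0 sorry,
standard axioms.  No item is closed; no summit, no crux and no mass gap is proved by this file.

WHAT.
* `exists_continuousOn_iUnion_of_ae` (generic) — «`f` is a.e. equal to a continuous function on `U`» is closed under countable unions: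
  continuous a.e.-equal versions agree on open overlaps (✓`Measure.eqOn_open_of_ae_eq`), so the local versions glue.
* ★ `exists_continuous_version` (kernel-generic) — if `S₁` satisfies `RPPos` and the measurable real kernel `K` (crux bound, a.e.
  invariant under every signed permutation of the axes) represents `S₁ 2` on compactly supported off-diagonal test functions, then
  `K` is a.e. equal to a function `Kc`, measurable, CONTINUOUS OFF `0`, with the same bound on `{u ≠ 0}`: the half-space versions of
  ✓`exists_continuous_halfSpace` on `{y₀ < −1/(m+1)}`, transported by the swaps `(0 μ)` and the total inversion (a.e. symmetries of `K`),
  cover `{y ≠ 0}` and glue; measurability by ✓`measurable_of_continuousOn_compl_singleton`; the bound holds on `{≠ 0}` because the open set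
  where it fails is null.
* ★ `continuousKernel_of_offDiagLimitAlong` — for every off-diagonal leg-scheme limit point under `MomentBounds6` (✓`real_repr_of_offDiagLimitAlong`
  + ✓`rpPos_normalize_of_offDiagLimitAlong`): a kernel `K`, measurable, `ContinuousOn K {≠ 0}`, `|K u| ≤ A (1 + ‖u‖⁻¹)⁸` off `0`, representing
  `S₁ 2` on EVERY off-diagonal Schwartz test function — i.e. the child `ContinuousKernel` of the owner's split of ⟨23036⟩
  (HOME `g23/Sketch23036SplitV2.lean`), and `subCurvatureKernel_rung_continuousKernel` in the crux's quantifier prefix.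
Together with ✓`softKernel_clauses_of_continuous_kernel` (p737216) this CLOSES THE SOFT HALF of `SubCurvatureKernel`: clauses (1)(2)(3)(4)(6)(7)
hold for every leg-scheme limit point; what remains is the SUB-CURVATURE clause (asymptotic freedom) — the crux.

HONEST LABEL: input (C) of the SOFT half of ⟨23036⟩, proved; the SUB-CURVATURE clause (asymptotic freedom of the continuum `tr F²` two-point
function) is the crux and is untouched; ⟨23036⟩ is an open problem; rung R2d still needs ⟨22566⟩ ⟨23036⟩ ⟨23037⟩; the Yang–Mills mass gap
is NOT proved; no summit is proved by a line.
-/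

set_option autoImplicit false

noncomputable section

open scoped SchwartzMap BigOperators Topology
open MeasureTheory Filter Set Metric Function
open Literature.MathematicalPhysics.QuantumFieldTheory Literature.MathematicalPhysics.QuantumLattice
open Literature.MathematicalPhysics.AQFT
open Summit.QuantumFields.YangMills.Cruxes.OSLegsFromFemtoAndGap.DlrCollarTransfer (MomentBounds6 RPPos)
open Summit.QuantumFields.YangMills.Cruxes.OSLegsAtWeakCouplingC.Sketch (IsSignedPerm)
open Summit.QuantumFields.YangMills.Theorems.ROT (IsLegScheme OffDiagLimitAlong)
open Summit.QuantumFields.YangMills.Theorems.NPointIsotropy.Negative (E4)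
open Summit.QuantumFields.YangMills.Theorems.F4SubCurvatureDoorGlobalReduction (isSignedPerm_trans isSignedPerm_neg isSignedPerm_swap
  swap_apply)
open Summit.QuantumFields.YangMills.Theorems.F4SubCurvatureDoorSubCurvatureKernelMollifier (isSignedPerm_timeReflection_trans_neg
  timeReflection_trans_neg_apply)
open Summit.QuantumFields.YangMills.Theorems.F4SubCurvatureDoorSubCurvatureKernelHalfSpace (exists_continuous_halfSpace)
open Summit.QuantumFields.YangMills.Theorems.F4SubCurvatureDoorSubCurvatureKernelGlued (volume_preimage_sub_eq_zero_iff)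
open Summit.QuantumFields.YangMills.Theorems.F4SubCurvatureDoorSubCurvatureKernelSymmetries (real_repr_of_offDiagLimitAlong)
open Summit.QuantumFields.YangMills.Theorems.F4SubCurvatureDoorSubCurvatureKernelRP (rpPos_normalize_of_offDiagLimitAlong)

namespace Summit.QuantumFields.YangMills.Theorems.F4SubCurvatureDoorSubCurvatureKernelContinuousVersion

/-! ## §1 Gluing local continuous versions -/

/-- **Gluing.**  If on each open set `U i` of a countable family `f` is a.e. equal to a function continuous on `U i`, then `f` is
a.e. equal to ONE function continuous on `⋃ U i` (and equal to `f` off the union). [folklore] -/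
theorem exists_continuousOn_iUnion_of_ae {X ι : Type*} [TopologicalSpace X] [MeasurableSpace X] [OpensMeasurableSpace X]
    [Countable ι] (μ : Measure X) [μ.IsOpenPosMeasure] (f : X → ℝ) (U : ι → Set X) (hU : ∀ i, IsOpen (U i))
    (h : ∀ i, ∃ g : X → ℝ, ContinuousOn g (U i) ∧ ∀ᵐ x ∂μ, x ∈ U i → f x = g x) :
    ∃ g : X → ℝ, ContinuousOn g (⋃ i, U i) ∧ (∀ x, x ∉ ⋃ i, U i → g x = f x) ∧ ∀ᵐ x ∂μ, f x = g x := by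
  classical
  choose g hgc hga using h
  -- the local versions agree on overlaps
  have hagree : ∀ i j, EqOn (g i) (g j) (U i ∩ U j) := by
    intro i j
    refine Measure.eqOn_open_of_ae_eq (μ := μ) ?_ ((hU i).inter (hU j)) ((hgc i).mono inter_subset_left)
      ((hgc j).mono inter_subset_right)
    rw [Filter.EventuallyEq, ae_restrict_iff' ((hU i).inter (hU j)).measurableSet]
    filter_upwards [hga i, hga j] with x hi hj hx
    rw [← hi hx.1, ← hj hx.2]
  -- the glued function
  set G : X → ℝ := fun x => if hx : ∃ i, x ∈ U i then g (Classical.choose hx) x else f x with hG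
  have hG_eq : ∀ i x, x ∈ U i → G x = g i x := by
    intro i x hx
    have hex : ∃ j, x ∈ U j := ⟨i, hx⟩
    simp only [hG, dif_pos hex]
    exact hagree _ i ⟨Classical.choose_spec hex, hx⟩
  refine ⟨G, fun x hx => ?_, fun x hx => ?_, ?_⟩
  · obtain ⟨i, hi⟩ := mem_iUnion.1 hx
    have hGi : ContinuousOn G (U i) := (hgc i).congr fun y hy => hG_eq i y hy
    exact (hGi.continuousAt ((hU i).mem_nhds hi)).continuousWithinAt
  · have : ¬ ∃ i, x ∈ U i := fun ⟨i, hi⟩ => hx (mem_iUnion.2 ⟨i, hi⟩)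
    simp only [hG, dif_neg this]
  · have hall : ∀ᵐ x ∂μ, ∀ i, x ∈ U i → f x = g i x := ae_all_iff.2 hga
    filter_upwards [hall] with x hx
    by_cases hex : ∃ i, x ∈ U i
    · obtain ⟨i, hi⟩ := hex
      rw [hG_eq i x hi]; exact hx i hi
    · simp only [hG, dif_neg hex]

/-! ## §2 ★ A version continuous off `0` -/

/-- ★ **CONTINUOUS VERSION OFF `0`** of an RP kernel with the crux bound and a.e. `W(B₄)` symmetry (kernel-generic). [cite: OS1973, §2 (E2)]
[cite: GlimmJaffeQP1987, §6.2] -/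
theorem exists_continuous_version (S₁ : SchwingerFamily E4) (hRP : RPPos S₁) (K : E4 → ℝ) (hKm : Measurable K) {A : ℝ}
    (hKb : ∀ u, |K u| ≤ A * (1 + ‖u‖⁻¹) ^ 8)
    (hsym : ∀ R : E4 ≃ₗᵢ[ℝ] E4, IsSignedPerm R → ∀ᵐ u : E4, K (R u) = K u)
    (hrep : ∀ F : 𝓢((Fin 2 → E4), ℂ), IsOffDiagonal F → HasCompactSupport (F : (Fin 2 → E4) → ℂ) →
      Integrable (fun x : Fin 2 → E4 => (K (x 0 - x 1) : ℂ) * F x) ∧ S₁ 2 F = ∫ x : Fin 2 → E4, (K (x 0 - x 1) : ℂ) * F x) :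
    ∃ Kc : E4 → ℝ, Measurable Kc ∧ ContinuousOn Kc {u : E4 | u ≠ 0} ∧ (∀ u, u ≠ 0 → |Kc u| ≤ A * (1 + ‖u‖⁻¹) ^ 8) ∧
      ∀ᵐ u : E4, K u = Kc u := by
  classical
  -- a.e. invariance under the spatial inversion `-θ`
  have hKP : ∀ᵐ u : E4, K (-(timeReflection 4 u)) = K u := by
    have h := hsym _ isSignedPerm_timeReflection_trans_neg
    filter_upwards [h] with u hu
    rwa [timeReflection_trans_neg_apply] at hu
  -- half-space versions
  have Hhalf : ∀ m : ℕ, ∃ Kc : E4 → ℝ, Continuous Kc ∧ ∀ᵐ y : E4, y 0 < -(1 / ((m : ℝ) + 1)) → K y = Kc y :=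
    fun m => exists_continuous_halfSpace S₁ hRP K hKm hKb hKP hrep (by positivity)
  choose Kh hKhc hKh using Hhalf
  -- the transporting signed permutations: `y ↦ (R y)₀ = ± y_μ`
  set Rf : Fin 4 → Bool → (E4 ≃ₗᵢ[ℝ] E4) := fun μ s =>
    if s then LinearIsometryEquiv.piLpCongrLeft 2 ℝ ℝ (Equiv.swap (0 : Fin 4) μ)
    else (LinearIsometryEquiv.neg ℝ).trans (LinearIsometryEquiv.piLpCongrLeft 2 ℝ ℝ (Equiv.swap (0 : Fin 4) μ)) with hRf
  have hRf_perm : ∀ μ s, IsSignedPerm (Rf μ s) := by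
    intro μ s
    cases s
    · simp only [hRf]; exact isSignedPerm_trans isSignedPerm_neg (isSignedPerm_swap μ)
    · simp only [hRf, if_true]; exact isSignedPerm_swap μ
  have hRf_zero : ∀ μ s (y : E4), (Rf μ s y) 0 = if s then y μ else -y μ := by
    intro μ s y
    cases s
    · simp only [hRf]
      show (LinearIsometryEquiv.piLpCongrLeft 2 ℝ ℝ (Equiv.swap (0 : Fin 4) μ) (-y)) 0 = -y μ
      rw [swap_apply, Equiv.swap_apply_left, PiLp.neg_apply]
    · simp only [hRf, if_true]
      rw [swap_apply, Equiv.swap_apply_left]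
  -- the open cover of `{y ≠ 0}` and the local versions
  set U : Fin 4 × Bool × ℕ → Set E4 := fun i => {y | (Rf i.1 i.2.1 y) 0 < -(1 / ((i.2.2 : ℝ) + 1))} with hUdef
  have hUo : ∀ i, IsOpen (U i) := fun i =>
    isOpen_lt (((EuclideanSpace.proj (0 : Fin 4) : E4 →L[ℝ] ℝ).continuous).comp (Rf i.1 i.2.1).continuous) continuous_const
  have hloc : ∀ i, ∃ g : E4 → ℝ, ContinuousOn g (U i) ∧ ∀ᵐ x : E4, x ∈ U i → K x = g x := by
    rintro ⟨μ, s, m⟩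
    refine ⟨fun y => Kh m (Rf μ s y), ((hKhc m).comp (Rf μ s).continuous).continuousOn, ?_⟩
    have h1 : ∀ᵐ y : E4, K (Rf μ s y) = K y := hsym _ (hRf_perm μ s)
    have h2 : ∀ᵐ y : E4, (Rf μ s y) 0 < -(1 / ((m : ℝ) + 1)) → K (Rf μ s y) = Kh m (Rf μ s y) :=
      ((Rf μ s).measurePreserving.quasiMeasurePreserving).ae (hKh m)
    filter_upwards [h1, h2] with y hy1 hy2 hyU
    rw [← hy1]; exact hy2 hyU
  have hcover : (⋃ i, U i) = {y : E4 | y ≠ 0} := by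
    ext y
    simp only [mem_iUnion, mem_setOf_eq, hUdef]
    constructor
    · rintro ⟨⟨μ, s, m⟩, hy⟩ h0
      rw [h0, map_zero, PiLp.zero_apply] at hy
      have : (0 : ℝ) < 1 / ((m : ℝ) + 1) := by positivity
      linarith
    · intro hy
      obtain ⟨μ, hμ⟩ : ∃ μ : Fin 4, y μ ≠ 0 := by
        by_contra h; push Not at h; exact hy (PiLp.ext h)
      rcases lt_or_gt_of_ne hμ with hneg | hpos
      · obtain ⟨m, hm⟩ := exists_nat_one_div_lt (show (0 : ℝ) < -y μ by linarith)
        refine ⟨⟨μ, true, m⟩, ?_⟩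
        show (Rf μ true y) 0 < -(1 / ((m : ℝ) + 1))
        rw [hRf_zero]; simp only [if_true]; linarith
      · obtain ⟨m, hm⟩ := exists_nat_one_div_lt hpos
        refine ⟨⟨μ, false, m⟩, ?_⟩
        show (Rf μ false y) 0 < -(1 / ((m : ℝ) + 1))
        rw [hRf_zero]; simp only [Bool.false_eq_true, if_false]; linarith
  -- glue
  obtain ⟨Kc, hKcc, hKcoff, hKcae⟩ := exists_continuousOn_iUnion_of_ae volume K U hUo hloc
  rw [hcover] at hKcc hKcoff
  have hKcm : Measurable Kc := by
    refine measurable_of_continuousOn_compl_singleton 0 ?_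
    rwa [show ({0}ᶜ : Set E4) = {u | u ≠ 0} from compl_singleton_eq 0]
  refine ⟨Kc, hKcm, hKcc, fun u hu => ?_, hKcae⟩
  -- the bound on `{≠ 0}`: the open set where it fails is null, hence empty
  set T : Set E4 := {u | u ≠ 0} ∩ (fun u => |Kc u| - A * (1 + ‖u‖⁻¹) ^ 8) ⁻¹' Ioi 0 with hT
  have hTo : IsOpen T := by
    refine ContinuousOn.isOpen_inter_preimage ?_ isOpen_ne isOpen_Ioi
    refine (continuous_abs.comp_continuousOn hKcc).sub (continuousOn_const.mul ((continuousOn_const.add ?_).pow 8))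
    exact (continuousOn_inv₀.comp continuous_norm.continuousOn fun u hu => norm_ne_zero_iff.2 hu)
  have hT0 : volume T = 0 := by
    rw [measure_eq_zero_iff_ae_notMem]
    filter_upwards [hKcae] with u hu hmem
    have h := hmem.2
    simp only [mem_preimage, mem_Ioi] at h
    rw [← hu] at h
    linarith [hKb u]
  have hTe : T = ∅ := (hTo.measure_eq_zero_iff volume).1 hT0
  by_contra hlt
  have : u ∈ T := ⟨hu, by simp only [mem_preimage, mem_Ioi]; linarith [not_le.1 hlt]⟩
  rw [hTe] at this
  exact this

/-! ## §3 ★ The continuous kernel of a leg-scheme limit point -/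

variable {G : Type} [Group G] [TopologicalSpace G] [IsTopologicalGroup G] [CompactSpace G]
  [MeasurableSpace G] [BorelSpace G]

/-- ★ **THE CONTINUOUS KERNEL (child `ContinuousKernel` of the split of ⟨23036⟩).**  Under `MomentBounds6`, every off-diagonal limit point
`S₁` of an admissible leg scheme has a two-point kernel `K : ℝ⁴ → ℝ`, measurable, CONTINUOUS OFF `0`, with `|K u| ≤ A (1 + ‖u‖⁻¹)⁸` off
`0`, representing `S₁ 2` on EVERY off-diagonal Schwartz test function. [cite: OS1973, §2 (E2)] [cite: GlimmJaffeQP1987, §6.2]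
[cite: Billingsley1999, Thm. 5.1] -/
theorem continuousKernel_of_offDiagLimitAlong (r : LatticeRep G) {a : ℝ → ℝ} (hapos : ∀ β, 0 < a β)
    (ha0 : Tendsto a atTop (𝓝 0)) (hMB : MomentBounds6 G r a) {sch : SpeciesScheme (YMSpecies G)}
    (hsch : IsLegScheme a sch) {φ : ℕ → ℕ} (hφ : Tendsto φ atTop atTop) {S₁ : SchwingerFamily E4}
    (hS₁ : OffDiagLimitAlong r sch φ S₁) :
    ∃ K : E4 → ℝ, Measurable K ∧ ContinuousOn K {x : E4 | x ≠ 0} ∧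
      (∃ A : ℝ, ∀ u : E4, u ≠ 0 → |K u| ≤ A * (1 + ‖u‖⁻¹) ^ 8) ∧
      (∀ F : 𝓢((Fin 2 → E4), ℂ), IsOffDiagonal F →
        Integrable (fun x : Fin 2 → E4 => (K (x 0 - x 1) : ℂ) * F x) ∧ S₁ 2 F = ∫ x : Fin 2 → E4, (K (x 0 - x 1) : ℂ) * F x) := by
  obtain ⟨K₀, hK₀m, ⟨A, hK₀b⟩, hrep₀, hsym₀⟩ := real_repr_of_offDiagLimitAlong r hapos ha0 hMB hsch hφ hS₁
  obtain ⟨S', -, hS'eq, -, hRP⟩ := rpPos_normalize_of_offDiagLimitAlong r hapos ha0 hMB hsch hφ hS₁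
  have h2 : S' 2 = S₁ 2 := hS'eq 2 (by norm_num)
  have hrep' : ∀ F : 𝓢((Fin 2 → E4), ℂ), IsOffDiagonal F → HasCompactSupport (F : (Fin 2 → E4) → ℂ) →
      Integrable (fun x : Fin 2 → E4 => (K₀ (x 0 - x 1) : ℂ) * F x) ∧ S' 2 F = ∫ x : Fin 2 → E4, (K₀ (x 0 - x 1) : ℂ) * F x :=
    fun F hF _ => by rw [h2]; exact hrep₀ F hF
  obtain ⟨K, hKm, hKc, hKb, hae⟩ := exists_continuous_version S' hRP K₀ hK₀m hK₀b hsym₀ hrep'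
  -- pull the a.e. equality back to configurations
  have hae' : ∀ᵐ x : Fin 2 → E4, (K (x 0 - x 1) : ℂ) = (K₀ (x 0 - x 1) : ℂ) := by
    set N : Set E4 := {u | K u ≠ K₀ u} with hN
    have hNm : MeasurableSet N := (measurableSet_eq_fun hKm hK₀m).compl
    have hN0 : volume N = 0 := by
      have := ae_iff.1 hae
      have e : {u : E4 | ¬K₀ u = K u} = N := by ext u; simp only [hN, mem_setOf_eq, ne_eq, eq_comm]
      rwa [e] at this
    have hpre := (volume_preimage_sub_eq_zero_iff N hNm).2 hN0
    rw [ae_iff]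
    refine measure_mono_null (fun x hx => ?_) hpre
    simp only [mem_setOf_eq, Complex.ofReal_inj] at hx ⊢
    exact hx
  refine ⟨K, hKm, hKc, ⟨A, hKb⟩, fun F hF => ?_⟩
  obtain ⟨hI, hS⟩ := hrep₀ F hF
  have haeF : (fun x : Fin 2 → E4 => (K (x 0 - x 1) : ℂ) * F x) =ᵐ[volume] fun x => (K₀ (x 0 - x 1) : ℂ) * F x :=
    hae'.mono fun x hx => by beta_reduce; rw [hx]
  exact ⟨hI.congr haeF.symm, by rw [hS]; exact (integral_congr_ae haeF).symm⟩

/-- ★ **`ContinuousKernel` in the crux's quantifier prefix** (`Theses/F4SubCurvatureDoor.lean` :338ff; the child of the owner's split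
`SubCurvatureKernel = ContinuousKernel ∧ SubCurvatureClause`, HOME `g23/Sketch23036SplitV2.lean`): for every compact simple `G`,
representation `r`, positive unit map `a → 0` with `MomentBounds6`, admissible leg scheme, subsequence `φ → ∞` and off-diagonal limit point
`S₁`, a two-point kernel measurable, continuous off `0`, with the crux bound off `0`, representing `S₁ 2` on every off-diagonal test
function. [cite: OS1973, §2 (E2)] [cite: GlimmJaffeQP1987, §6.2] -/
theorem subCurvatureKernel_rung_continuousKernel :
    ∀ (G : Type) [Group G] [TopologicalSpace G] [IsTopologicalGroup G] [CompactSpace G], IsCompactSimpleLieGroup G →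
      letI : MeasurableSpace G := borel G; haveI : BorelSpace G := ⟨rfl⟩;
      ∀ (r : LatticeRep G) (a : ℝ → ℝ), (∀ β, 0 < a β) → Tendsto a atTop (nhds 0) → MomentBounds6 G r a →
        ∀ sch : SpeciesScheme (YMSpecies G), IsLegScheme a sch → ∀ φ : ℕ → ℕ, Tendsto φ atTop atTop →
          ∀ S₁ : SchwingerFamily E4, OffDiagLimitAlong r sch φ S₁ →
            ∃ K : E4 → ℝ, Measurable K ∧ ContinuousOn K {x : E4 | x ≠ 0} ∧
              (∃ A : ℝ, ∀ u : E4, u ≠ 0 → |K u| ≤ A * (1 + ‖u‖⁻¹) ^ 8) ∧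
              (∀ F : 𝓢((Fin 2 → E4), ℂ), IsOffDiagonal F →
                Integrable (fun x : Fin 2 → E4 => (K (x 0 - x 1) : ℂ) * F x) ∧
                  S₁ 2 F = ∫ x : Fin 2 → E4, (K (x 0 - x 1) : ℂ) * F x) := by
  intro G _ _ _ _ _
  letI : MeasurableSpace G := borel G
  haveI : BorelSpace G := ⟨rfl⟩
  intro r a hapos ha0 hMB sch hsch φ hφ S₁ hS₁
  exact continuousKernel_of_offDiagLimitAlong r hapos ha0 hMB hsch hφ hS₁

end Summit.QuantumFields.YangMills.Theorems.F4SubCurvatureDoorSubCurvatureKernelContinuousVersion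

end
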